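import Literature.AlgebraicGeometry.Frobenioids.Prop55SubRatStdSlot
import Literature.AlgebraicGeometry.Frobenioids.ArithmeticFrobenioidRational
import Literature.AlgebraicGeometry.Frobenioids.ModelFrobenioidBiratNormalized
import Literature.AlgebraicGeometry.Frobenioids.MotivatingExamplesSubProofs3
import HarnessLib

/-!
# Frobenioids I, Theorem 6.4 (i) "of isotropic and rationally standard type" for `C_{K/F}` AT THE parameters of
# Def. 4.5 (iii): everything but the Frobenius-compact object of `(C^un-tr)^birat` — PROOF

Mochizuki, *The geometry of Frobenioids I: the general theory*, Kyushu J. Math. **62** (2008) 293–400, Thm. 6.4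
(i), kurims text p. 114 ("the Frobenioids `C`, `C^pf`, `C^rlf`, `C^un-tr`, `(C^pf)^un-tr` are of isotropic and
rationally standard type, but not of group-like type"), proof p. 115; Def. 4.5 (iii) p. 86. [cite: MochizukiFrdI2008, Thm. 6.4 (i) p.114]

PROOF-ONLY (seat abc-iut-L6-t10 gen 2, S3 sub-DAG holder, node T64i/L10 at THE data). The typed node
`Thm64i_frobenioid M R` (abc-iut-L1-t3, `ArithmeticFrobenioids.lean`) is a SCHEMA over the Def. 4.5 (iii)
parameters `R`. Here it is read at THE parameters `PreFrobenioid.rsParams hF (fun a 𝔭 => PrimarySupp a 𝔭)` of THE constructed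
arithmetic Frobenioid `C_{K/F}` (`B = C^birat` of Prop. 4.4, `Supp` = the support of Def. 2.4 (i)(d) read on primary elements (`PrimarySupp`, abc-iut `Prop55SubRatStdSlot.lean`),
`SU`/`BU` = `C^un-tr` and its birationalization):
* `arith_isRational_rsParams` — every object of `C_{K/F}` is rational w.r.t. THE `(C^birat, Supp)`
  (`isRational_arith` + T64i/L08 `Thm64i_L08_strictlyRational_data_holds` + the support axiom by `Iff.rfl`);
* `arith_isOfBiratFrobeniusNormalizedType_rsParams` — THE `C^birat` is birationally Frobenius-normalized
  (abc-iut-L1-d10's `isOfBiratFrobeniusNormalizedType_of_isDivisorial`);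
* `Thm64i_frobenioid_rsParams_iff` — **`Thm64i_frobenioid (arithModelFrobenioid F K) (THE R)` ⟺ `(C^un-tr)^birat`
  admits a Frobenius-compact object** (Def. 4.5 (iii)(b); the data-level core of that clause is landed as
  `NumberField.frobCompact_data`, its transport to THE `(C^un-tr)^birat` is the one remaining input), and the
  unconditional direction `Thm64i_frobenioid_rsParams_of_frobCompact`.
No definitions; nothing here bears on [IUTchIII] or asserts anything about abc.
-/

noncomputable section

namespace Literature.AlgebraicGeometry.Frobenioids

open CategoryTheory Opposite NumberField

variable (F : Type) [Field F] [NumberField F] (K : Type) [Field K] [Algebra F K] [IsGalois F K]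

/-- **Every object of `C_{K/F}` is rational w.r.t. THE `(C^birat, Supp)`** ("it is immediate from the definition
of `B` that `C` is of [strictly] rational type", p. 115). [cite: MochizukiFrdI2008, Thm. 6.4 (i) p.115] -/
theorem arith_isRational_rsParams (A : arithFrobenioid F K) :
    PreFrobenioidData.IsRational (PreFrobenioid.rsParams (arithFrobenioid_isFrobenioid F K) fun a 𝔭 => PrimarySupp a 𝔭).B (PreFrobenioid.rsParams (arithFrobenioid_isFrobenioid F K) fun a 𝔭 => PrimarySupp a 𝔭).Supp A :=
  isRational_arith F K Thm64i_L08_strictlyRational_data_holds (arithFrobenioid_isFrobenioid F K)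
    (PreFrobenioid.hasBiratSquares_of_isFrobenioid (arithFrobenioid_isFrobenioid F K)) _
    (fun _ _ _ => Iff.rfl) A

/-- **THE birationalization `C_{K/F}^birat` is of birationally Frobenius-normalized type** (Thm. 5.2 (ii) via
abc-iut-L1-d10: `Φ` divisorial, `B` group-like). [cite: MochizukiFrdI2008, Thm. 5.2 (ii) p.100] -/
theorem arith_isOfBiratFrobeniusNormalizedType_rsParams :
    PreFrobenioidData.IsOfBiratFrobeniusNormalizedType (PreFrobenioid.rsParams (arithFrobenioid_isFrobenioid F K) fun a 𝔭 => PrimarySupp a 𝔭).B :=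
  ModelFrobenioid.isOfBiratFrobeniusNormalizedType_of_isDivisorial (arithFrobenioid_isFrobenioid F K)
    (PreFrobenioid.hasBiratSquares_of_isFrobenioid (arithFrobenioid_isFrobenioid F K))
    (arithDivisorFunctor_isDivisorial F K) (unitsFunctor_isGroupLike F K)

/-- **Theorem 6.4 (i) at THE parameters of Def. 4.5 (iii)**: "[`C` is] of isotropic and rationally standard type,
but not of group-like type" holds for THE `(C^birat, Supp, C^un-tr, (C^un-tr)^birat)` IF AND
ONLY IF `(C^un-tr)^birat` admits a Frobenius-compact object (Def. 4.5 (iii)(b)) — isotropic, standard, not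
group-like, birationally Frobenius-normalized and rational being PROVED. [cite: MochizukiFrdI2008, Thm. 6.4 (i) p.114] -/
theorem Thm64i_frobenioid_rsParams_iff :
    Thm64i_frobenioid (arithModelFrobenioid F K) (PreFrobenioid.rsParams (arithFrobenioid_isFrobenioid F K) fun a 𝔭 => PrimarySupp a 𝔭) ↔
      ∃ X : (PreFrobenioid.rsParams (arithFrobenioid_isFrobenioid F K) fun a 𝔭 => PrimarySupp a 𝔭).BU.Birat, (PreFrobenioid.rsParams (arithFrobenioid_isFrobenioid F K) fun a 𝔭 => PrimarySupp a 𝔭).BU.ops.IsFrobeniusCompact X := by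
  rw [Thm64i_frobenioid_arith_iff]
  exact ⟨fun h => h.2.2, fun h =>
    ⟨arith_isOfBiratFrobeniusNormalizedType_rsParams F K, arith_isRational_rsParams F K, h⟩⟩

/-- **Theorem 6.4 (i) at THE parameters, from a Frobenius-compact object of `(C^un-tr)^birat`.**
[cite: MochizukiFrdI2008, Thm. 6.4 (i) p.114] -/
theorem Thm64i_frobenioid_rsParams_of_frobCompact
    (h : ∃ X : (PreFrobenioid.rsParams (arithFrobenioid_isFrobenioid F K) fun a 𝔭 => PrimarySupp a 𝔭).BU.Birat, (PreFrobenioid.rsParams (arithFrobenioid_isFrobenioid F K) fun a 𝔭 => PrimarySupp a 𝔭).BU.ops.IsFrobeniusCompact X) :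
    Thm64i_frobenioid (arithModelFrobenioid F K) (PreFrobenioid.rsParams (arithFrobenioid_isFrobenioid F K) fun a 𝔭 => PrimarySupp a 𝔭) :=
  (Thm64i_frobenioid_rsParams_iff F K).mpr h

/-- In particular **`C_{K/F}` is of rationally standard type w.r.t. THE parameters iff `(C^un-tr)^birat` admits a
Frobenius-compact object**. [cite: MochizukiFrdI2008, Def. 4.5 (iii) p.86] -/
theorem arith_isOfRationallyStandardType_rsParams_iff :
    (arithFrobenioidOps F K).IsOfRationallyStandardType (PreFrobenioid.rsParams (arithFrobenioid_isFrobenioid F K) fun a 𝔭 => PrimarySupp a 𝔭) ↔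
      ∃ X : (PreFrobenioid.rsParams (arithFrobenioid_isFrobenioid F K) fun a 𝔭 => PrimarySupp a 𝔭).BU.Birat, (PreFrobenioid.rsParams (arithFrobenioid_isFrobenioid F K) fun a 𝔭 => PrimarySupp a 𝔭).BU.ops.IsFrobeniusCompact X :=
  ⟨fun h => h.frobCompact, fun h =>
    ⟨arith_isOfBiratFrobeniusNormalizedType_rsParams F K, arith_isRational_rsParams F K,
      isOfStandardType_arith F K, h⟩⟩

end Literature.AlgebraicGeometry.Frobenioids

end
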